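import Literature.MathematicalPhysics.QuantumLattice.HubbardMatsubaraShellRowSum
import Literature.MathematicalPhysics.QuantumLattice.HubbardMatsubaraShellNearIdentity
import HarnessLib

/-!
# The shell row sums and the shell tadpole with the POSITION `ℓ¹` NORM of the frame (`Σ_z ‖Ǩ_L(z)‖`) in place of `coeffNorm 0 K`

Topic `MathematicalPhysics/QuantumLattice`; twin of `HubbardMatsubaraShellRowSum` / `HubbardMatsubaraShellTadpole` (row and column sums of the
Matsubara shell covariance `S` between cutoffs `M ≤ M″` pulled back to the `N`-grid, and its equal-time entries).  There every size is expressed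
through `c_e = 4 + |μ| + coeffNorm 0 K` (the PLAIN coefficient weight of the frame `K`).  For the frames of the KL programme's counterterm
scheme (`FrameOK`: sup-norm and derivative bounds of the frame, degree up to `2²¹·16ⁿ`) the coefficient weight is not small, but the position
`ℓ¹` norm `Σ_z ‖Ǩ_L(z)‖` of the frame's kernel is (`…EngineFramePosKernelPieces.sum_norm_framePosKernel_le_linear_of_frameOK`: `≤ κ_R·|U|`).
Both uses of `c_e` — the sup of the renormalised band `|e_K| ≤ 4 + |μ| + (sup |K|)` and the position `ℓ¹` norm of the band
`Σ_b ‖Σ_q χ_q(b) e_K(q)‖ ≤ L²(4 + |μ| + Σ_z ‖Ǩ_L(z)‖)` — are controlled by ANY `c_K ≥ Σ_z ‖Ǩ_L(z)‖` (Fourier inversion on the torus: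
`|K(p_q)| ≤ Σ_z ‖Ǩ_L(z)‖`), so the whole file is re-run with `c = 4 + |μ| + c_K`:

* `abs_eval_latticeMomentum_le_sum_norm_framePosKernel`, `abs_nambuXiCT_le_of_framePosKernel`, `sum_norm_charSum_nambuXiCT_le_of_framePosKernel`;
* **`rowSum_/colSum_/gridWeight_mul_rowSum_gridSub_hubbardCovShellCT_le_l1`** — `Σ_Y ‖(SᵀSS)(X,Y)‖ ≤ N/(π√(2M)) + Nβc/(2π²M) + NL²c²β²/(2π³M(2M+1))`;
* **`norm_gridSub_hubbardCovShellCT_apply_equalTime_le_l1`** (+ primed, + `…_le_of_sameTime_l1` on the regular grid) — equal-time entries `≤ c·β/(2π²M)`.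

Everything is proved; no definitions beyond private abbreviations, no named facts.

## Sources

W. de S. Pedra, M. Salmhofer, Commun. Math. Phys. 282 (2008) 797–818, §5 Lemma 5.2 [`PedraSalmhofer2008`]; G. Benfatto, A. Giuliani,
V. Mastropietro, Ann. Henri Poincaré 7 (2006) 809–898, §2.1 (2.3), §2.2 (2.14) [`BenfattoGiulianiMastropietro2006`]; Ann. Henri Poincaré 4 (2003)
137–193, §1.2 (2.10) [`BenfattoGiulianiMastropietro2003`].  The `[cite: …]` tags LOCATE the constructs; the statements are elementary.
-/

noncomputable section

namespace Literature.MathematicalPhysics.QuantumLattice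

open Finset Complex Literature.Probability.LatticeModels GrassmannAlgebra
open scoped ComplexConjugate

variable {L : ℕ} [NeZero L] {M M'' N : ℕ}

/-! ### §0 The sup and the position `ℓ¹` norm of the band from the `ℓ¹` norm of the frame kernel -/

/-- **Fourier inversion bound**: `|K(p_{q⃗})| ≤ Σ_z ‖Ǩ_L(z)‖` at every lattice momentum. [cite: BenfattoGiulianiMastropietro2003, §1.2 The model (2.10)] -/
theorem abs_eval_latticeMomentum_le_sum_norm_framePosKernel (K : TrigPolyC4v) (k : TorusSite 2 L) :
    |K.eval (latticeMomentum L k)| ≤ ∑ z : TorusSite 2 L, ‖framePosKernel L K z‖ := by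
  have hL0 : (0 : ℝ) < L := by exact_mod_cast Nat.pos_of_ne_zero (NeZero.ne L)
  have hL : (0 : ℝ) < (L : ℝ) ^ 2 := by positivity
  have hid := sum_sum_framePosKernel_mul_torusChar (L := L) K k k
  rw [if_pos rfl] at hid
  have hnorm : ‖(L : ℂ) ^ 2 * (K.eval (latticeMomentum L k) : ℂ)‖ ≤ (L : ℝ) ^ 2 * ∑ z : TorusSite 2 L, ‖framePosKernel L K z‖ := by
    rw [← hid]
    refine (norm_sum_le _ _).trans ?_
    have hrow : ∀ x : TorusSite 2 L, ∑ y : TorusSite 2 L, ‖framePosKernel L K (x - y) * (torusChar k x * conj (torusChar k y))‖ =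
        ∑ z : TorusSite 2 L, ‖framePosKernel L K z‖ := by
      intro x
      rw [← Fintype.sum_equiv (Equiv.subLeft x) (fun y => ‖framePosKernel L K (x - y) * (torusChar k x * conj (torusChar k y))‖)
        (fun z => ‖framePosKernel L K z‖) (fun y => by
          rw [Equiv.subLeft_apply, norm_mul, norm_mul, Complex.norm_conj, norm_torusChar, norm_torusChar, mul_one, mul_one])]
    calc ∑ x : TorusSite 2 L, ‖∑ y : TorusSite 2 L, framePosKernel L K (x - y) * (torusChar k x * conj (torusChar k y))‖
        ≤ ∑ x : TorusSite 2 L, ∑ y : TorusSite 2 L, ‖framePosKernel L K (x - y) * (torusChar k x * conj (torusChar k y))‖ :=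
          sum_le_sum fun x _ => norm_sum_le _ _
      _ = (L : ℝ) ^ 2 * ∑ z : TorusSite 2 L, ‖framePosKernel L K z‖ := by
          simp_rw [hrow]
          rw [sum_const, card_univ, nsmul_eq_mul]
          simp [Fintype.card_pi, ZMod.card]
  rw [norm_mul, norm_pow, Complex.norm_natCast, Complex.norm_real, Real.norm_eq_abs] at hnorm
  exact le_of_mul_le_mul_left hnorm hL

/-- `|e_K(k⃗)| ≤ 4 + |μ| + c_K` for any `c_K ≥ Σ_z ‖Ǩ_L(z)‖`. [cite: BenfattoGiulianiMastropietro2006, §2.1 (2.3)] -/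
theorem abs_nambuXiCT_le_of_framePosKernel (μ : ℝ) {K : TrigPolyC4v} {cK : ℝ} (hcK : ∑ z : TorusSite 2 L, ‖framePosKernel L K z‖ ≤ cK)
    (kv : TorusSite 2 L) : |nambuXiCT L μ K kv| ≤ 4 + |μ| + cK := by
  rw [nambuXiCT]
  have h1 : |torusBand L kv| ≤ 4 := by have := abs_torusBand_le L kv; norm_num at this; exact this
  have h2 := (abs_eval_latticeMomentum_le_sum_norm_framePosKernel K kv).trans hcK
  calc |torusBand L kv - μ - K.eval (latticeMomentum L kv)| ≤ |torusBand L kv - μ| + |K.eval (latticeMomentum L kv)| := abs_sub _ _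
    _ ≤ |torusBand L kv| + |μ| + |K.eval (latticeMomentum L kv)| := by linarith [abs_sub (torusBand L kv) μ]
    _ ≤ _ := by linarith

/-- **The position `ℓ¹` norm of the renormalised band with the frame's kernel norm**: `Σ_b ‖Σ_{q⃗} χ_{q⃗}(b) e_K(q⃗)‖ ≤ L²·(4 + |μ| + c_K)`.
[cite: BenfattoGiulianiMastropietro2003, §1.2 The model (2.10)] -/
theorem sum_norm_charSum_nambuXiCT_le_of_framePosKernel (μ : ℝ) {K : TrigPolyC4v} {cK : ℝ}
    (hcK : ∑ z : TorusSite 2 L, ‖framePosKernel L K z‖ ≤ cK) :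
    ∑ bv : TorusSite 2 L, ‖∑ qv : TorusSite 2 L, torusChar qv bv * (nambuXiCT L μ K qv : ℂ)‖ ≤ (L : ℝ) ^ 2 * (4 + |μ| + cK) := by
  classical
  have hsplit : ∀ bv : TorusSite 2 L, ∑ qv : TorusSite 2 L, torusChar qv bv * (nambuXiCT L μ K qv : ℂ) =
      -4 * ((L : ℂ) ^ 2 * harmonicPosKernel L 1 0 (-bv)) - (μ : ℂ) * (if bv = 0 then (L : ℂ) ^ 2 else 0) -
        (L : ℂ) ^ 2 * framePosKernel L K (-bv) := by
    intro bv
    rw [← sum_torusChar_mul_harmonic_eq, ← sum_torusChar_left bv, ← sum_torusChar_mul_eval_eq, mul_sum, mul_sum, ← sum_sub_distrib,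
      ← sum_sub_distrib]
    refine sum_congr rfl fun qv _ => ?_
    rw [nambuXiCT, torusBand_eq_neg_four_mul_harmonic]
    push_cast
    ring
  simp_rw [hsplit]
  have hpt : ∀ bv : TorusSite 2 L,
      ‖-4 * ((L : ℂ) ^ 2 * harmonicPosKernel L 1 0 (-bv)) - (μ : ℂ) * (if bv = 0 then (L : ℂ) ^ 2 else 0) - (L : ℂ) ^ 2 * framePosKernel L K (-bv)‖ ≤
        (L : ℝ) ^ 2 * (4 * ‖harmonicPosKernel L 1 0 (-bv)‖) + (L : ℝ) ^ 2 * (|μ| * (if bv = 0 then 1 else 0)) +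
          (L : ℝ) ^ 2 * ‖framePosKernel L K (-bv)‖ := by
    intro bv
    refine (norm_sub_le _ _).trans (add_le_add ((norm_sub_le _ _).trans (add_le_add ?_ ?_)) ?_)
    · rw [norm_mul, norm_mul, norm_neg, norm_pow, Complex.norm_natCast, RCLike.norm_ofNat]; linarith
    · rw [norm_mul, Complex.norm_real, Real.norm_eq_abs]
      split_ifs
      · rw [norm_pow, Complex.norm_natCast]; linarith
      · rw [norm_zero]; simp
    · rw [norm_mul, norm_pow, Complex.norm_natCast]
  refine (sum_le_sum fun bv _ => hpt bv).trans ?_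
  rw [sum_add_distrib, sum_add_distrib, ← mul_sum, ← mul_sum, ← mul_sum, ← mul_sum, ← mul_sum, Fintype.sum_ite_eq', mul_one,
    Fintype.sum_equiv (Equiv.neg (TorusSite 2 L)) (fun z => ‖harmonicPosKernel L 1 0 (-z)‖) (fun z => ‖harmonicPosKernel L 1 0 z‖)
      (fun z => rfl),
    Fintype.sum_equiv (Equiv.neg (TorusSite 2 L)) (fun z => ‖framePosKernel L K (-z)‖) (fun z => ‖framePosKernel L K z‖)
      (fun z => rfl)]
  have h1 := sum_norm_harmonicPosKernel_le (L := L) 1 0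
  have hL : (0 : ℝ) ≤ (L : ℝ) ^ 2 := by positivity
  nlinarith [mul_le_mul_of_nonneg_left h1 hL, mul_le_mul_of_nonneg_left hcK hL, abs_nonneg μ]

/-! ### §1 The three pieces of the shell symbol (as in `HubbardMatsubaraShellRowSum`) -/



/-- **The three-piece decomposition of the shell symbol below the floor.** [cite: PedraSalmhofer2008, §5 Lemma 5.2] -/
theorem shellSymbolCT_eq_pieces_l1 {β : ℝ} (hβ : 0 < β) (h : M ≤ M'') (μ : ℝ) (K : TrigPolyC4v) {Λ : ℝ} (hΛ : 0 < Λ)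
    (hΛle : Λ ≤ Real.pi * (2 * M + 1) / β) :
    shellSymbolCT L h β μ K Λ =
      (fun ks => (fun i : MatsubaraIdx M'' => if i ∈ MatsubaraIdx.shell h then ((β * (L : ℝ) ^ 2 : ℝ) : ℂ) * (I / matsubaraFreq β M'' i) else 0) ks.1.1) + (fun ks => (fun i : MatsubaraIdx M'' => if i ∈ MatsubaraIdx.shell h then ((β * (L : ℝ) ^ 2 / matsubaraFreq β M'' i ^ 2 : ℝ) : ℂ) else 0) ks.1.1 * (nambuXiCT L μ K ks.1.2 : ℂ)) + (fun ks : FreqMomentum L M'' × Fin 2 => if ks.1.1 ∈ MatsubaraIdx.shell h then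
      -(((β * (L : ℝ) ^ 2 : ℝ) : ℂ) * (((nambuXiCT L μ K ks.1.2 ^ 2 / matsubaraFreq β M'' ks.1.1 ^ 2 : ℝ) : ℂ) /
        ((nambuXiCT L μ K ks.1.2 : ℂ) - I * matsubaraFreq β M'' ks.1.1))) else 0) := by
  funext ks
  simp only [Pi.add_apply]
  by_cases hk : ks.1.1 ∈ MatsubaraIdx.shell h
  · rw [shellSymbolCT_eq_of_floor hβ h μ K hΛ hΛle ks hk, if_pos hk, if_pos hk, if_pos hk,
      one_div_uvDen_eq_three _ (matsubaraFreq_ne_zero (M := M'') hβ.ne' ks.1.1)]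
    push_cast
    have hω : (matsubaraFreq β M'' ks.1.1 : ℂ) ≠ 0 := by exact_mod_cast matsubaraFreq_ne_zero (M := M'') hβ.ne' ks.1.1
    field_simp
    ring
  · rw [shellSymbolCT_of_not_mem h β μ K Λ hk, if_neg hk, if_neg hk, if_neg hk]
    simp

/-! ### §2 The sizes of the pieces -/

omit [NeZero L] in
/-- `Σ_i ‖T1 i‖² = (βL²)²·Σ_shell 1/ω² ≤ (βL²)²·β²/(2π²M)`. [cite: PedraSalmhofer2008, §5 Lemma 5.2] -/
theorem sum_norm_sq_pieceT1_le_l1 {β : ℝ} (hβ : 0 < β) (hM : 1 ≤ M) (h : M ≤ M'') :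
    ∑ i : MatsubaraIdx M'', ‖(fun i : MatsubaraIdx M'' => if i ∈ MatsubaraIdx.shell h then ((β * (L : ℝ) ^ 2 : ℝ) : ℂ) * (I / matsubaraFreq β M'' i) else 0) i‖ ^ 2 ≤ (β * (L : ℝ) ^ 2) ^ 2 * (β ^ 2 / (2 * Real.pi ^ 2 * M)) := by
  classical
  have hpt : ∀ i : MatsubaraIdx M'', ‖(fun i : MatsubaraIdx M'' => if i ∈ MatsubaraIdx.shell h then ((β * (L : ℝ) ^ 2 : ℝ) : ℂ) * (I / matsubaraFreq β M'' i) else 0) i‖ ^ 2 =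
      if i ∈ MatsubaraIdx.shell h then (β * (L : ℝ) ^ 2) ^ 2 * (1 / matsubaraFreq β M'' i ^ 2) else 0 := by
    intro i
    dsimp only
    split_ifs
    · rw [norm_mul, Complex.norm_real, Real.norm_of_nonneg (by positivity), norm_div, Complex.norm_I, Complex.norm_real,
        Real.norm_eq_abs, mul_pow, div_pow, one_pow, sq_abs]
    · rw [norm_zero]; ring
  simp_rw [hpt]
  rw [Finset.sum_ite_mem, Finset.univ_inter, ← mul_sum]
  exact mul_le_mul_of_nonneg_left (sum_shell_one_div_sq_le hβ hM h) (by positivity)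

omit [NeZero L] in
/-- `Σ_i ‖T2 i‖ = βL²·Σ_shell 1/ω² ≤ βL²·β²/(2π²M)`. [cite: PedraSalmhofer2008, §5 Lemma 5.2] -/
theorem sum_norm_pieceT2_le_l1 {β : ℝ} (hβ : 0 < β) (hM : 1 ≤ M) (h : M ≤ M'') :
    ∑ i : MatsubaraIdx M'', ‖(fun i : MatsubaraIdx M'' => if i ∈ MatsubaraIdx.shell h then ((β * (L : ℝ) ^ 2 / matsubaraFreq β M'' i ^ 2 : ℝ) : ℂ) else 0) i‖ ≤ β * (L : ℝ) ^ 2 * (β ^ 2 / (2 * Real.pi ^ 2 * M)) := by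
  classical
  have hpt : ∀ i : MatsubaraIdx M'', ‖(fun i : MatsubaraIdx M'' => if i ∈ MatsubaraIdx.shell h then ((β * (L : ℝ) ^ 2 / matsubaraFreq β M'' i ^ 2 : ℝ) : ℂ) else 0) i‖ =
      if i ∈ MatsubaraIdx.shell h then β * (L : ℝ) ^ 2 * (1 / matsubaraFreq β M'' i ^ 2) else 0 := by
    intro i
    dsimp only
    split_ifs
    · rw [Complex.norm_real, Real.norm_of_nonneg (by positivity), mul_one_div]
    · rw [norm_zero]
  simp_rw [hpt]
  rw [Finset.sum_ite_mem, Finset.univ_inter, ← mul_sum]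
  exact mul_le_mul_of_nonneg_left (sum_shell_one_div_sq_le hβ hM h) (by positivity)

/-- `‖T3 (k,σ)‖ ≤ [shell]·βL²·c²·(1/ω²)·(1/|ω|)`, `c = 4 + |μ| + c_K`, `c_K ≥ Σ_z ‖Ǩ_L(z)‖`. [cite: PedraSalmhofer2008, §5 Lemma 5.2] -/
theorem norm_pieceT3_le_l1 {β : ℝ} (hβ : 0 < β) (h : M ≤ M'') (μ : ℝ) (K : TrigPolyC4v) {cK : ℝ}
    (hcK : ∑ z : TorusSite 2 L, ‖framePosKernel L K z‖ ≤ cK) (ks : FreqMomentum L M'' × Fin 2) :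
    ‖(fun ks : FreqMomentum L M'' × Fin 2 => if ks.1.1 ∈ MatsubaraIdx.shell h then
      -(((β * (L : ℝ) ^ 2 : ℝ) : ℂ) * (((nambuXiCT L μ K ks.1.2 ^ 2 / matsubaraFreq β M'' ks.1.1 ^ 2 : ℝ) : ℂ) /
        ((nambuXiCT L μ K ks.1.2 : ℂ) - I * matsubaraFreq β M'' ks.1.1))) else 0) ks‖ ≤
      if ks.1.1 ∈ MatsubaraIdx.shell h then
        β * (L : ℝ) ^ 2 * ((4 + |μ| + cK) ^ 2 * (1 / matsubaraFreq β M'' ks.1.1 ^ 2) * (1 / |matsubaraFreq β M'' ks.1.1|))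
      else 0 := by
  dsimp only
  split_ifs with hk
  · have hω := matsubaraFreq_ne_zero (M := M'') hβ.ne' ks.1.1
    set ω := matsubaraFreq β M'' ks.1.1
    set e := nambuXiCT L μ K ks.1.2
    have he := abs_nambuXiCT_le_of_framePosKernel μ hcK ks.1.2
    have hd : |ω| ≤ ‖(e : ℂ) - I * ω‖ := by
      rw [show (e : ℂ) - I * ω = ((e : ℝ) : ℂ) + ((-ω : ℝ) : ℂ) * I by push_cast; ring, Complex.norm_add_mul_I, ← Real.sqrt_sq_eq_abs]
      exact Real.sqrt_le_sqrt (by nlinarith [sq_nonneg e])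
    have hd0 : 0 < ‖(e : ℂ) - I * ω‖ := lt_of_lt_of_le (abs_pos.2 hω) hd
    rw [norm_neg, norm_mul, Complex.norm_real, Real.norm_of_nonneg (by positivity), norm_div, Complex.norm_real, Real.norm_of_nonneg
      (by positivity)]
    refine mul_le_mul_of_nonneg_left ?_ (by positivity)
    rw [div_eq_mul_one_div, div_eq_mul_one_div (e ^ 2)]
    refine mul_le_mul ?_ (one_div_le_one_div_of_le (abs_pos.2 hω) hd) (by positivity) (by positivity)
    refine mul_le_mul_of_nonneg_right ?_ (by positivity)
    rw [← sq_abs]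
    exact pow_le_pow_left₀ (abs_nonneg _) he 2
  · rw [norm_zero]

/-- `Σ_k ‖T3 (k,σ)‖ ≤ L²·βL²·c²·(β/(π(2M+1)))·(β²/(2π²M))`, `c = 4 + |μ| + c_K`. [cite: PedraSalmhofer2008, §5 Lemma 5.2] -/
theorem sum_norm_pieceT3_le_l1 {β : ℝ} (hβ : 0 < β) (hM : 1 ≤ M) (h : M ≤ M'') (μ : ℝ) (K : TrigPolyC4v) {cK : ℝ}
    (hcK : ∑ z : TorusSite 2 L, ‖framePosKernel L K z‖ ≤ cK) (σ : Fin 2) :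
    ∑ k : FreqMomentum L M'', ‖(fun ks : FreqMomentum L M'' × Fin 2 => if ks.1.1 ∈ MatsubaraIdx.shell h then
      -(((β * (L : ℝ) ^ 2 : ℝ) : ℂ) * (((nambuXiCT L μ K ks.1.2 ^ 2 / matsubaraFreq β M'' ks.1.1 ^ 2 : ℝ) : ℂ) /
        ((nambuXiCT L μ K ks.1.2 : ℂ) - I * matsubaraFreq β M'' ks.1.1))) else 0) (k, σ)‖ ≤
      (L : ℝ) ^ 2 * (β * (L : ℝ) ^ 2 * ((4 + |μ| + cK) ^ 2 * ((β / (Real.pi * (2 * M + 1))) * (β ^ 2 / (2 * Real.pi ^ 2 * M))))) := by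
  classical
  set ce : ℝ := 4 + |μ| + cK with hce
  set B : ℝ := β / (Real.pi * (2 * M + 1)) with hB
  have hB0 : 0 ≤ B := by rw [hB]; positivity
  calc ∑ k : FreqMomentum L M'', ‖(fun ks : FreqMomentum L M'' × Fin 2 => if ks.1.1 ∈ MatsubaraIdx.shell h then
      -(((β * (L : ℝ) ^ 2 : ℝ) : ℂ) * (((nambuXiCT L μ K ks.1.2 ^ 2 / matsubaraFreq β M'' ks.1.1 ^ 2 : ℝ) : ℂ) /
        ((nambuXiCT L μ K ks.1.2 : ℂ) - I * matsubaraFreq β M'' ks.1.1))) else 0) (k, σ)‖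
      ≤ ∑ k : FreqMomentum L M'', (if k.1 ∈ MatsubaraIdx.shell h then
          β * (L : ℝ) ^ 2 * (ce ^ 2 * (1 / matsubaraFreq β M'' k.1 ^ 2) * B) else 0) := by
        refine sum_le_sum fun k _ => (norm_pieceT3_le_l1 hβ h μ K hcK (k, σ)).trans ?_
        dsimp only
        split_ifs with hk
        · have hsup := one_div_abs_matsubaraFreq_le_of_mem_shell hβ h hk
          rw [hB]
          gcongr
        · exact le_rfl
    _ = ∑ kv : TorusSite 2 L, ∑ i ∈ MatsubaraIdx.shell h, β * (L : ℝ) ^ 2 * (ce ^ 2 * (1 / matsubaraFreq β M'' i ^ 2) * B) := by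
        rw [Fintype.sum_prod_type, sum_comm]
        refine sum_congr rfl fun kv _ => ?_
        dsimp only
        rw [Finset.sum_ite_mem, Finset.univ_inter]
    _ = (L : ℝ) ^ 2 * ((β * (L : ℝ) ^ 2 * (ce ^ 2 * B)) * ∑ i ∈ MatsubaraIdx.shell h, 1 / matsubaraFreq β M'' i ^ 2) := by
        rw [sum_const, card_univ, nsmul_eq_mul]
        simp only [Fintype.card_pi, ZMod.card, prod_const, Finset.card_univ, Fintype.card_fin]
        push_cast
        congr 1
        rw [mul_sum]
        exact sum_congr rfl fun i _ => by ring
    _ ≤ (L : ℝ) ^ 2 * ((β * (L : ℝ) ^ 2 * (ce ^ 2 * B)) * (β ^ 2 / (2 * Real.pi ^ 2 * M))) := by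
        gcongr
        exact sum_shell_one_div_sq_le hβ hM h
    _ = _ := by rw [hB]; ring

/-! ### §3 The `ℓ¹` norm of the character sum of the shell symbol, and the row / column sums -/

variable [NeZero N]

/-- **The `ℓ¹` norm of the character sum of the shell symbol on the `N`-grid** (`0 < β`, `1 ≤ M ≤ M″`, `2M″ ≤ N`, `0 < Λ ≤ π(2M+1)/β`):
`≤ N/(π√(2M)) + N·β·c_e/(2π²M) + N·L²·c_e²·β²/(2π³M(2M+1))`, `c = 4 + |μ| + c_K`. [cite: PedraSalmhofer2008, §5 Lemma 5.2] -/
theorem sum_sum_norm_charSum_shellSymbolCT_le_l1 {β : ℝ} (hβ : 0 < β) (hM : 1 ≤ M) (h : M ≤ M'') (hN : 2 * M'' ≤ N) (μ : ℝ)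
    (K : TrigPolyC4v) {cK : ℝ} (hcK : ∑ z : TorusSite 2 L, ‖framePosKernel L K z‖ ≤ cK)
    {Λ : ℝ} (hΛ : 0 < Λ) (hΛle : Λ ≤ Real.pi * (2 * M + 1) / β) (σ : Fin 2) :
    ∑ a : TorusSite 1 N, ∑ bv : TorusSite 2 L,
        ‖∑ q₀ : TorusSite 1 N, ∑ qv : TorusSite 2 L, torusChar q₀ a * torusChar qv bv * gridSymbol L M'' N β (shellSymbolCT L h β μ K Λ) σ q₀ qv‖ ≤
      (N : ℝ) / (Real.pi * Real.sqrt (2 * M)) + (N : ℝ) * β * (4 + |μ| + cK) / (2 * Real.pi ^ 2 * M) +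
        (N : ℝ) * (L : ℝ) ^ 2 * (4 + |μ| + cK) ^ 2 * β ^ 2 / (2 * Real.pi ^ 3 * M * (2 * M + 1)) := by
  have hL : (0 : ℝ) < L := by exact_mod_cast Nat.pos_of_ne_zero (NeZero.ne L)
  have hM0 : (0 : ℝ) < M := by exact_mod_cast hM
  set ce : ℝ := 4 + |μ| + cK with hce
  have hce0 : 0 ≤ ce := by rw [hce]; have := (sum_nonneg fun z _ => norm_nonneg (framePosKernel L K z)).trans hcK; positivity
  -- split the symbol and the character sums
  rw [shellSymbolCT_eq_pieces_l1 hβ h μ K hΛ hΛle]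
  have hsplit : ∀ (a : TorusSite 1 N) (bv : TorusSite 2 L),
      ∑ q₀ : TorusSite 1 N, ∑ qv : TorusSite 2 L, torusChar q₀ a * torusChar qv bv *
          gridSymbol L M'' N β ((fun ks => (fun i : MatsubaraIdx M'' => if i ∈ MatsubaraIdx.shell h then ((β * (L : ℝ) ^ 2 : ℝ) : ℂ) * (I / matsubaraFreq β M'' i) else 0) ks.1.1) + (fun ks => (fun i : MatsubaraIdx M'' => if i ∈ MatsubaraIdx.shell h then ((β * (L : ℝ) ^ 2 / matsubaraFreq β M'' i ^ 2 : ℝ) : ℂ) else 0) ks.1.1 * (nambuXiCT L μ K ks.1.2 : ℂ)) +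
            (fun ks : FreqMomentum L M'' × Fin 2 => if ks.1.1 ∈ MatsubaraIdx.shell h then
      -(((β * (L : ℝ) ^ 2 : ℝ) : ℂ) * (((nambuXiCT L μ K ks.1.2 ^ 2 / matsubaraFreq β M'' ks.1.1 ^ 2 : ℝ) : ℂ) /
        ((nambuXiCT L μ K ks.1.2 : ℂ) - I * matsubaraFreq β M'' ks.1.1))) else 0)) σ q₀ qv =
        (∑ q₀ : TorusSite 1 N, ∑ qv : TorusSite 2 L, torusChar q₀ a * torusChar qv bv * gridSymbol L M'' N β (fun ks => (fun i : MatsubaraIdx M'' => if i ∈ MatsubaraIdx.shell h then ((β * (L : ℝ) ^ 2 : ℝ) : ℂ) * (I / matsubaraFreq β M'' i) else 0) ks.1.1) σ q₀ qv) +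
        (∑ q₀ : TorusSite 1 N, ∑ qv : TorusSite 2 L, torusChar q₀ a * torusChar qv bv *
            gridSymbol L M'' N β (fun ks => (fun i : MatsubaraIdx M'' => if i ∈ MatsubaraIdx.shell h then ((β * (L : ℝ) ^ 2 / matsubaraFreq β M'' i ^ 2 : ℝ) : ℂ) else 0) ks.1.1 * (nambuXiCT L μ K ks.1.2 : ℂ)) σ q₀ qv) +
        (∑ q₀ : TorusSite 1 N, ∑ qv : TorusSite 2 L, torusChar q₀ a * torusChar qv bv * gridSymbol L M'' N β ((fun ks : FreqMomentum L M'' × Fin 2 => if ks.1.1 ∈ MatsubaraIdx.shell h then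
      -(((β * (L : ℝ) ^ 2 : ℝ) : ℂ) * (((nambuXiCT L μ K ks.1.2 ^ 2 / matsubaraFreq β M'' ks.1.1 ^ 2 : ℝ) : ℂ) /
        ((nambuXiCT L μ K ks.1.2 : ℂ) - I * matsubaraFreq β M'' ks.1.1))) else 0)) σ q₀ qv) := by
    intro a bv
    simp only [gridSymbol_add, mul_add, sum_add_distrib]
  simp_rw [hsplit]
  refine (sum_le_sum fun a _ => sum_le_sum fun bv _ => norm_add₃_le).trans ?_
  simp only [sum_add_distrib]
  refine add_le_add (add_le_add ?_ ?_) ?_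
  · -- (T1): δ in space, Plancherel in time
    refine (sum_sum_norm_charSum_gridSymbol_fst_le hN β (fun i : MatsubaraIdx M'' => if i ∈ MatsubaraIdx.shell h then ((β * (L : ℝ) ^ 2 : ℝ) : ℂ) * (I / matsubaraFreq β M'' i) else 0) σ).trans ?_
    have hS := sum_norm_sq_pieceT1_le_l1 (L := L) hβ hM h
    calc (L : ℝ) ^ 2 * ((N : ℝ) * Real.sqrt ((1 / (β * (L : ℝ) ^ 2)) ^ 4 * ∑ i : MatsubaraIdx M'', ‖(fun i : MatsubaraIdx M'' => if i ∈ MatsubaraIdx.shell h then ((β * (L : ℝ) ^ 2 : ℝ) : ℂ) * (I / matsubaraFreq β M'' i) else 0) i‖ ^ 2))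
        ≤ (L : ℝ) ^ 2 * ((N : ℝ) * Real.sqrt ((1 / (β * (L : ℝ) ^ 2)) ^ 4 * ((β * (L : ℝ) ^ 2) ^ 2 * (β ^ 2 / (2 * Real.pi ^ 2 * M))))) := by
          gcongr
      _ = (N : ℝ) / (Real.pi * Real.sqrt (2 * M)) := by
          have hid : (1 / (β * (L : ℝ) ^ 2)) ^ 4 * ((β * (L : ℝ) ^ 2) ^ 2 * (β ^ 2 / (2 * Real.pi ^ 2 * M))) =
              (1 / ((L : ℝ) ^ 2 * Real.pi * Real.sqrt (2 * M))) ^ 2 := by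
            simp only [div_pow, one_pow, mul_pow, Real.sq_sqrt (show (0 : ℝ) ≤ 2 * M by positivity)]
            field_simp
          rw [hid, Real.sqrt_sq (by positivity)]
          field_simp
  · -- (T2): position kernel of the band × sup in time
    refine (sum_sum_norm_charSum_gridSymbol_mul_le hN β (fun i : MatsubaraIdx M'' => if i ∈ MatsubaraIdx.shell h then ((β * (L : ℝ) ^ 2 / matsubaraFreq β M'' i ^ 2 : ℝ) : ℂ) else 0) (fun kv => (nambuXiCT L μ K kv : ℂ)) σ).trans ?_
    have h2 := sum_norm_pieceT2_le_l1 (L := L) hβ hM h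
    have hb := sum_norm_charSum_nambuXiCT_le_of_framePosKernel (L := L) μ hcK
    calc (N : ℝ) * ((1 / (β * (L : ℝ) ^ 2)) ^ 2 * ∑ i : MatsubaraIdx M'', ‖(fun i : MatsubaraIdx M'' => if i ∈ MatsubaraIdx.shell h then ((β * (L : ℝ) ^ 2 / matsubaraFreq β M'' i ^ 2 : ℝ) : ℂ) else 0) i‖) *
          ∑ bv : TorusSite 2 L, ‖∑ qv : TorusSite 2 L, torusChar qv bv * (nambuXiCT L μ K qv : ℂ)‖
        ≤ (N : ℝ) * ((1 / (β * (L : ℝ) ^ 2)) ^ 2 * (β * (L : ℝ) ^ 2 * (β ^ 2 / (2 * Real.pi ^ 2 * M)))) * ((L : ℝ) ^ 2 * ce) := by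
          gcongr
      _ = (N : ℝ) * β * ce / (2 * Real.pi ^ 2 * M) := by field_simp
  · -- (T3): crude
    refine (sum_sum_norm_charSum_gridSymbol_le_card_mul hN β ((fun ks : FreqMomentum L M'' × Fin 2 => if ks.1.1 ∈ MatsubaraIdx.shell h then
      -(((β * (L : ℝ) ^ 2 : ℝ) : ℂ) * (((nambuXiCT L μ K ks.1.2 ^ 2 / matsubaraFreq β M'' ks.1.1 ^ 2 : ℝ) : ℂ) /
        ((nambuXiCT L μ K ks.1.2 : ℂ) - I * matsubaraFreq β M'' ks.1.1))) else 0)) σ).trans ?_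
    have h3' := sum_norm_pieceT3_le_l1 (L := L) hβ hM h μ K hcK σ
    calc (N : ℝ) * (L : ℝ) ^ 2 * ((1 / (β * (L : ℝ) ^ 2)) ^ 2 * ∑ k : FreqMomentum L M'', ‖(fun ks : FreqMomentum L M'' × Fin 2 => if ks.1.1 ∈ MatsubaraIdx.shell h then
      -(((β * (L : ℝ) ^ 2 : ℝ) : ℂ) * (((nambuXiCT L μ K ks.1.2 ^ 2 / matsubaraFreq β M'' ks.1.1 ^ 2 : ℝ) : ℂ) /
        ((nambuXiCT L μ K ks.1.2 : ℂ) - I * matsubaraFreq β M'' ks.1.1))) else 0) (k, σ)‖)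
        ≤ (N : ℝ) * (L : ℝ) ^ 2 * ((1 / (β * (L : ℝ) ^ 2)) ^ 2 *
            ((L : ℝ) ^ 2 * (β * (L : ℝ) ^ 2 * (ce ^ 2 * ((β / (Real.pi * (2 * M + 1))) * (β ^ 2 / (2 * Real.pi ^ 2 * M))))))) := by
          gcongr
      _ = (N : ℝ) * (L : ℝ) ^ 2 * ce ^ 2 * β ^ 2 / (2 * Real.pi ^ 3 * M * (2 * M + 1)) := by
          field_simp

/-- **Row sums of the shell covariance on the time grid** (`hrow` of the determinant-bounded step for the shell integration):
`Σ_Y ‖(Sᵀ·S·S)(X,Y)‖ ≤ N/(π√(2M)) + Nβc_e/(2π²M) + NL²c_e²β²/(2π³M(2M+1))` for every grid leg `X`; UNIFORM in `M″`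
(`0 < β`, `1 ≤ M ≤ M″`, `2M″ ≤ N`, `0 < Λ ≤ π(2M+1)/β`, seed `0`). [cite: PedraSalmhofer2008, §5 Lemma 5.2] -/
theorem rowSum_gridSub_hubbardCovShellCT_le_l1 {β : ℝ} (hβ : 0 < β) (hM : 1 ≤ M) (h : M ≤ M'') (hN : 2 * M'' ≤ N) (μ : ℝ)
    (K : TrigPolyC4v) {cK : ℝ} (hcK : ∑ z : TorusSite 2 L, ‖framePosKernel L K z‖ ≤ cK)
    {Λ : ℝ} (hΛ : 0 < Λ) (hΛle : Λ ≤ Real.pi * (2 * M + 1) / β) (X : GridLeg (GridPoint L N)) :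
    ∑ Y : GridLeg (GridPoint L N), ‖((hubbardGridSub L M'' β N).transpose * hubbardCovShellCT L h β μ 0 K Λ * hubbardGridSub L M'' β N) X Y‖ ≤
      (N : ℝ) / (Real.pi * Real.sqrt (2 * M)) + (N : ℝ) * β * (4 + |μ| + cK) / (2 * Real.pi ^ 2 * M) +
        (N : ℝ) * (L : ℝ) ^ 2 * (4 + |μ| + cK) ^ 2 * β ^ 2 / (2 * Real.pi ^ 3 * M * (2 * M + 1)) := by
  rw [hubbardCovShellCT_zero_seed]
  exact sum_norm_gridSub_pullback_row_le hβ.ne' hN _ (fun σ => sum_sum_norm_charSum_shellSymbolCT_le_l1 hβ hM h hN μ K hcK hΛ hΛle σ) X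

/-- **Column sums of the shell covariance on the time grid** (`hcol`). [cite: PedraSalmhofer2008, §5 Lemma 5.2] -/
theorem colSum_gridSub_hubbardCovShellCT_le_l1 {β : ℝ} (hβ : 0 < β) (hM : 1 ≤ M) (h : M ≤ M'') (hN : 2 * M'' ≤ N) (μ : ℝ)
    (K : TrigPolyC4v) {cK : ℝ} (hcK : ∑ z : TorusSite 2 L, ‖framePosKernel L K z‖ ≤ cK)
    {Λ : ℝ} (hΛ : 0 < Λ) (hΛle : Λ ≤ Real.pi * (2 * M + 1) / β) (Y : GridLeg (GridPoint L N)) :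
    ∑ X : GridLeg (GridPoint L N), ‖((hubbardGridSub L M'' β N).transpose * hubbardCovShellCT L h β μ 0 K Λ * hubbardGridSub L M'' β N) X Y‖ ≤
      (N : ℝ) / (Real.pi * Real.sqrt (2 * M)) + (N : ℝ) * β * (4 + |μ| + cK) / (2 * Real.pi ^ 2 * M) +
        (N : ℝ) * (L : ℝ) ^ 2 * (4 + |μ| + cK) ^ 2 * β ^ 2 / (2 * Real.pi ^ 3 * M * (2 * M + 1)) := by
  rw [hubbardCovShellCT_zero_seed]
  exact sum_norm_gridSub_pullback_col_le hβ.ne' hN _ (fun σ => sum_sum_norm_charSum_shellSymbolCT_le_l1 hβ hM h hN μ K hcK hΛ hΛle σ) Y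

/-- **The decay constant of the shell against the grid weight**: `(β/N)·Σ_Y ‖(SᵀSS)(X,Y)‖ ≤ β/(π√(2M)) + β²c_e/(2π²M) + β³L²c_e²/(2π³M(2M+1))`
— `O(β/√M)`, uniform in the outer cutoff `M″`; at `M ≥ 2¹⁰β²L²` every term is `O(1/L)`. [cite: PedraSalmhofer2008, §5 Lemma 5.2] -/
theorem gridWeight_mul_rowSum_hubbardCovShellCT_le_l1 {β : ℝ} (hβ : 0 < β) (hM : 1 ≤ M) (h : M ≤ M'') (hN : 2 * M'' ≤ N) (μ : ℝ)
    (K : TrigPolyC4v) {cK : ℝ} (hcK : ∑ z : TorusSite 2 L, ‖framePosKernel L K z‖ ≤ cK)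
    {Λ : ℝ} (hΛ : 0 < Λ) (hΛle : Λ ≤ Real.pi * (2 * M + 1) / β) (X : GridLeg (GridPoint L N)) :
    β / N * ∑ Y : GridLeg (GridPoint L N),
        ‖((hubbardGridSub L M'' β N).transpose * hubbardCovShellCT L h β μ 0 K Λ * hubbardGridSub L M'' β N) X Y‖ ≤
      β / (Real.pi * Real.sqrt (2 * M)) + β ^ 2 * (4 + |μ| + cK) / (2 * Real.pi ^ 2 * M) +
        β ^ 3 * (L : ℝ) ^ 2 * (4 + |μ| + cK) ^ 2 / (2 * Real.pi ^ 3 * M * (2 * M + 1)) := by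
  have hN0 : (0 : ℝ) < N := by exact_mod_cast Nat.pos_of_ne_zero (NeZero.ne N)
  refine (mul_le_mul_of_nonneg_left (rowSum_gridSub_hubbardCovShellCT_le_l1 hβ hM h hN μ K hcK hΛ hΛle X) (by positivity)).trans (le_of_eq ?_)
  field_simp

/-! ### §4 The equal-time entries of the shell (the tadpole), with `c = 4 + |μ| + c_K` -/

variable {P : Type*}

/-- **Equal-time `(+,−)` entries of the pulled-back shell covariance are `O(β/M)`**: `‖(SᵀSS)((a,σ,+),(b,σ,−))‖ ≤ (4 + |μ| + c_K)·β/(2π²M)` for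
`τ a = τ b`, below the shell floor, for any `c_K ≥ Σ_z ‖Ǩ_L(z)‖`. [cite: BenfattoGiulianiMastropietro2006, §2.2 (2.14)] -/
theorem norm_gridSub_hubbardCovShellCT_apply_equalTime_le_l1 {β : ℝ} (hβ : 0 < β) (hM : 1 ≤ M) (h : M ≤ M'') (μ : ℝ) (K : TrigPolyC4v)
    {cK : ℝ} (hcK : ∑ z : TorusSite 2 L, ‖framePosKernel L K z‖ ≤ cK)
    {Λ : ℝ} (hΛ : 0 < Λ) (hΛle : Λ ≤ Real.pi * (2 * M + 1) / β) (x : P → TorusSite 2 L) (τ : P → ℝ) {a b : P} (hab : τ a = τ b)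
    (σ : Fin 2) :
    ‖((gridSubMatrix L M'' β x τ).transpose * hubbardCovShellCT L h β μ 0 K Λ * gridSubMatrix L M'' β x τ) ((a, σ), 0) ((b, σ), 1)‖ ≤
      (4 + |μ| + cK) * β / (2 * Real.pi ^ 2 * M) := by
  classical
  have hL : (0 : ℝ) < L := by exact_mod_cast Nat.pos_of_ne_zero (NeZero.ne L)
  have hcK0 : 0 ≤ cK := (sum_nonneg fun z _ => norm_nonneg (framePosKernel L K z)).trans hcK
  -- the spatial phase of momentum `k⃗` between the two points
  set φ : TorusSite 2 L → ℝ := fun kv => ∑ i, latticeMomentum L kv i * (((x a i).val : ℝ) - ((x b i).val : ℝ)) with hφ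
  have hphase : ∀ k : FreqMomentum L M'', vertexPhase L M'' β k (x a) (τ a) - vertexPhase L M'' β k (x b) (τ b) = φ k.2 := by
    intro k
    simp only [vertexPhase, hab, hφ, mul_sub, Finset.sum_sub_distrib]
    ring
  rw [hubbardCovShellCT_zero_seed, gridSub_pullback_normalCovariance_apply_zero_one, if_pos rfl]
  simp_rw [hphase]
  have hinner : ∀ kv : TorusSite 2 L, ∑ j : MatsubaraIdx M'', shellSymbolCT L h β μ K Λ ((j, kv), σ) =
      ((β * (L : ℝ) ^ 2 : ℝ) : ℂ) * ∑ j ∈ MatsubaraIdx.shell h, 1 / (-I * matsubaraFreq β M'' j + nambuXiCT L μ K kv) := by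
    intro kv
    have hpt : ∀ j : MatsubaraIdx M'', shellSymbolCT L h β μ K Λ ((j, kv), σ) =
        if j ∈ MatsubaraIdx.shell h then ((β * (L : ℝ) ^ 2 : ℝ) : ℂ) * (1 / (-I * matsubaraFreq β M'' j + nambuXiCT L μ K kv)) else 0 := by
      intro j
      split_ifs with hj
      · exact shellSymbolCT_eq_of_floor hβ h μ K hΛ hΛle ((j, kv), σ) hj
      · exact shellSymbolCT_of_not_mem h β μ K Λ (ks := ((j, kv), σ)) hj
    simp_rw [hpt]
    rw [Finset.sum_ite_mem, Finset.univ_inter, mul_sum]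
  rw [Fintype.sum_prod_type, sum_comm]
  have hkv : ∀ kv : TorusSite 2 L, ∑ j : MatsubaraIdx M'', ((1 / (β * (L : ℝ) ^ 2) : ℝ) : ℂ) ^ 2 *
      (Complex.exp (((φ kv : ℝ) : ℂ) * Complex.I) * shellSymbolCT L h β μ K Λ ((j, kv), σ)) =
      ((1 / (β * (L : ℝ) ^ 2) : ℝ) : ℂ) ^ 2 * Complex.exp (((φ kv : ℝ) : ℂ) * Complex.I) *
        (((β * (L : ℝ) ^ 2 : ℝ) : ℂ) * ∑ j ∈ MatsubaraIdx.shell h, 1 / (-I * matsubaraFreq β M'' j + nambuXiCT L μ K kv)) := by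
    intro kv
    rw [← hinner kv, mul_sum]
    exact sum_congr rfl fun j _ => by ring
  simp_rw [hkv]
  have hpt : ∀ kv : TorusSite 2 L, ‖((1 / (β * (L : ℝ) ^ 2) : ℝ) : ℂ) ^ 2 * Complex.exp (((φ kv : ℝ) : ℂ) * Complex.I) *
      (((β * (L : ℝ) ^ 2 : ℝ) : ℂ) * ∑ j ∈ MatsubaraIdx.shell h, 1 / (-I * matsubaraFreq β M'' j + nambuXiCT L μ K kv))‖ ≤
      (1 / (β * (L : ℝ) ^ 2)) ^ 2 * ((β * (L : ℝ) ^ 2) * ((4 + |μ| + cK) * (β ^ 2 / (2 * Real.pi ^ 2 * M)))) := by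
    intro kv
    rw [norm_mul, norm_mul, norm_mul, norm_pow, Complex.norm_real, Real.norm_eq_abs, sq_abs, Complex.norm_exp_ofReal_mul_I, mul_one,
      Complex.norm_real, Real.norm_of_nonneg (by positivity)]
    refine mul_le_mul_of_nonneg_left (mul_le_mul_of_nonneg_left ?_ (by positivity)) (by positivity)
    exact (norm_sum_shell_one_div_le hβ hM h _).trans
      (mul_le_mul_of_nonneg_right (abs_nambuXiCT_le_of_framePosKernel μ hcK kv) (by positivity))
  refine (norm_sum_le _ _).trans ((sum_le_sum fun kv _ => hpt kv).trans (le_of_eq ?_))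
  rw [sum_const, card_univ, nsmul_eq_mul]
  simp only [Fintype.card_pi, ZMod.card, prod_const, Finset.card_univ, Fintype.card_fin]
  push_cast
  field_simp

/-- The equal-time `(−,+)` entries (antisymmetry). [cite: BenfattoGiulianiMastropietro2006, §2.2 (2.14)] -/
theorem norm_gridSub_hubbardCovShellCT_apply_equalTime_le_l1' {β : ℝ} (hβ : 0 < β) (hM : 1 ≤ M) (h : M ≤ M'') (μ : ℝ) (K : TrigPolyC4v)
    {cK : ℝ} (hcK : ∑ z : TorusSite 2 L, ‖framePosKernel L K z‖ ≤ cK)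
    {Λ : ℝ} (hΛ : 0 < Λ) (hΛle : Λ ≤ Real.pi * (2 * M + 1) / β) (x : P → TorusSite 2 L) (τ : P → ℝ) {a b : P} (hab : τ a = τ b)
    (σ : Fin 2) :
    ‖((gridSubMatrix L M'' β x τ).transpose * hubbardCovShellCT L h β μ 0 K Λ * gridSubMatrix L M'' β x τ) ((a, σ), 1) ((b, σ), 0)‖ ≤
      (4 + |μ| + cK) * β / (2 * Real.pi ^ 2 * M) := by
  rw [hubbardCovShellCT_zero_seed, gridSub_pullback_normalCovariance_apply_one_zero, norm_neg, ← hubbardCovShellCT_zero_seed]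
  exact norm_gridSub_hubbardCovShellCT_apply_equalTime_le_l1 hβ hM h μ K hcK hΛ hΛle x τ hab.symm σ

omit [NeZero N] in
/-- **On the same time slice of the regular `N`-grid every entry of the pulled-back shell covariance is `≤ (4 + |μ| + c_K)·β/(2π²M)`**
(below the floor; different spins or equal charges give `0`). [cite: BenfattoGiulianiMastropietro2006, §2.2 (2.14)] -/
theorem norm_gridSub_hubbardCovShellCT_le_of_sameTime_l1 {β : ℝ} (hβ : 0 < β) (hM : 1 ≤ M) (h : M ≤ M'') (μ : ℝ) (K : TrigPolyC4v)
    {cK : ℝ} (hcK : ∑ z : TorusSite 2 L, ‖framePosKernel L K z‖ ≤ cK)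
    {Λ : ℝ} (hΛ : 0 < Λ) (hΛle : Λ ≤ Real.pi * (2 * M + 1) / β) {A B : GridLeg (GridPoint L N)} (hAB : SameTime A B) :
    ‖((hubbardGridSub L M'' β N).transpose * hubbardCovShellCT L h β μ 0 K Λ * hubbardGridSub L M'' β N) A B‖ ≤
      (4 + |μ| + cK) * β / (2 * Real.pi ^ 2 * M) := by
  have hcK0 : 0 ≤ cK := (sum_nonneg fun z _ => norm_nonneg (framePosKernel L K z)).trans hcK
  have ht0 : 0 ≤ (4 + |μ| + cK) * β / (2 * Real.pi ^ 2 * M) := by positivity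
  obtain ⟨⟨a, σ⟩, c⟩ := A
  obtain ⟨⟨b, σ'⟩, c'⟩ := B
  have hab : a.1 = b.1 := hAB
  set x : GridPoint L N → TorusSite 2 L := fun p => p.2 with hx
  set τ : GridPoint L N → ℝ := fun p => gridTime β N p.1 with hτdef
  have hτ : τ a = τ b := by show gridTime β N a.1 = gridTime β N b.1; rw [hab]
  have hS : hubbardGridSub L M'' β N = gridSubMatrix L M'' β x τ := rfl
  rw [hS]
  by_cases hcc : c = c'
  · rw [hubbardCovShellCT_zero_seed, gridSub_pullback_normalCovariance_apply_of_charge_eq β x τ _ (Y := ((a, σ), c)) (Y' := ((b, σ'), c')) hcc,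
      norm_zero]
    exact ht0
  by_cases hσ : σ = σ'
  · subst hσ
    have hc2 : (c = 0 ∧ c' = 1) ∨ (c = 1 ∧ c' = 0) := by
      rcases Fin.exists_fin_two.1 ⟨c, rfl⟩ with hc | hc <;> rcases Fin.exists_fin_two.1 ⟨c', rfl⟩ with hc' | hc' <;> simp_all
    rcases hc2 with ⟨hc, hc'⟩ | ⟨hc, hc'⟩
    · rw [hc, hc']
      exact norm_gridSub_hubbardCovShellCT_apply_equalTime_le_l1 hβ hM h μ K hcK hΛ hΛle x τ (a := a) (b := b) hτ σ
    · rw [hc, hc']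
      exact norm_gridSub_hubbardCovShellCT_apply_equalTime_le_l1' hβ hM h μ K hcK hΛ hΛle x τ (a := a) (b := b) hτ σ
  · -- different spins: the entry vanishes
    have hc2 : (c = 0 ∧ c' = 1) ∨ (c = 1 ∧ c' = 0) := by
      rcases Fin.exists_fin_two.1 ⟨c, rfl⟩ with hc | hc <;> rcases Fin.exists_fin_two.1 ⟨c', rfl⟩ with hc' | hc' <;> simp_all
    have h0 : ((gridSubMatrix L M'' β x τ).transpose * hubbardCovShellCT L h β μ 0 K Λ * gridSubMatrix L M'' β x τ) ((a, σ), c) ((b, σ'), c') = 0 := by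
      rw [hubbardCovShellCT_zero_seed]
      rcases hc2 with ⟨hc, hc'⟩ | ⟨hc, hc'⟩
      · rw [hc, hc', gridSub_pullback_normalCovariance_apply_zero_one, if_neg hσ]
      · rw [hc, hc', gridSub_pullback_normalCovariance_apply_one_zero, gridSub_pullback_normalCovariance_apply_zero_one, if_neg (Ne.symm hσ),
          neg_zero]
    rw [h0, norm_zero]
    exact ht0

end Literature.MathematicalPhysics.QuantumLattice

end
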